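import Literature.Probability.RandomPlanarGeometry.SkorokhodEmbedding
import Literature.Probability.RandomPlanarGeometry.CompensatedMartingale
import HarnessLib

/-!
# Skorokhod embedding: the embedding times follow the quadratic sums (LSW §3.3)

Topic `Probability/RandomPlanarGeometry`, sub-namespace `SkorokhodEmbedding`. Everything here is
PROVED; no named fact is introduced.

Lawler–Schramm–Werner (2004), proof of Thm. 3.7 (reused for Thm. 4.4), second application of
Doob's inequality: with `τ_n` the Skorokhod embedding times of the martingale `M` and
`Y_n := ∑_{j<n} (M_{j+1} - M_j)²`, the identities `E[τ_{n+1} - τ_n | B[0,τ_n]] =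
E[(B_{τ_{n+1}} - B_{τ_n})² | B[0,τ_n]]` and `E[(τ_{n+1} - τ_n)² | B[0,τ_n]] = O(δ⁴)` give
"`E[((τ_{n+1} - Y_{n+1}) - (τ_n - Y_n))² | B[0,τ_n]] = O(δ⁴)`,
`E[(τ_{n+1} - Y_{n+1}) - (τ_n - Y_n) | B[0,τ_n]] = 0`. Doob's inequality therefore implies
`P[max_{n ≤ N} |τ_n - Y_n| > δ^{1/2}] = O(T δ)`."

This file packages the output of the embedding (`exists_embedding`) as a structure
`EmbeddingWitness D N` (so that further files can work with a fixed witness), and proves the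
displayed estimate in the quantitative form
`Q{max_{k ≤ N} |τ_k - Y_k(X)| ≥ λ} ≤ N · (512 C₄ + 32) δ⁴ / λ²` (`measureReal_max_tau_sub_quad_ge_le`).

## References

* G. F. Lawler, O. Schramm, W. Werner, Ann. Probab. 32 (2004), §3.3, proof of Thm. 3.7.
-/

noncomputable section

open MeasureTheory ProbabilityTheory Filter Set
open scoped NNReal ENNReal Topology

namespace Literature.Probability.RandomPlanarGeometry.SkorokhodEmbedding

open Literature.Probability.Process Literature.Probability.RandomPlanarGeometry

variable [MeasurableSpace C(ℝ≥0, ℝ)]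
variable {Ω Λ : Type} [Fintype Ω] [MeasurableSpace Ω] [MeasurableSingletonClass Ω]
  [DecidableEq Λ] [Countable Λ] [MeasurableSpace Λ] [MeasurableSingletonClass Λ]
  {D : MartingaleData Ω Λ} {N : ℕ}

/-! ### Embedding witnesses -/

/-- **A Skorokhod embedding witness** of the martingale data `D` up to the horizon `N`: the data
and properties produced by `exists_embedding` (Lawler–Schramm–Werner (2004), Lemma 3.8) — a
probability space `(Ω', Q)`, the sampled point `X ~ P`, the Brownian path `B`, embedding times
`τ`, filtration `G`, labels `Hn`, and their laws / adaptedness / embedding identity / oscillation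
bound / integrability / compensator identity / second-moment bound / transition law.
[cite: LawlerSchrammWerner2004, Lemma 3.8] -/
structure EmbeddingWitness (D : MartingaleData Ω Λ) (N : ℕ) where
  /-- the sample space -/
  Ω' : Type
  /-- its σ-algebra -/
  mΩ' : MeasurableSpace Ω'
  /-- the probability law -/
  Q : Measure Ω'
  prob : IsProbabilityMeasure Q
  /-- the sampled point of the finite probability space -/
  X : Ω' → Ω
  /-- the Brownian path -/
  B : Ω' → C(ℝ≥0, ℝ)
  /-- the embedding times -/
  τ : ℕ → Ω' → ℝ≥0
  /-- the filtration -/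
  G : ℕ → MeasurableSpace Ω'
  /-- the labels (histories) -/
  Hn : ℕ → Ω' → Λ
  hX : Measurable X
  lawX : Q.map X = D.P
  hB : Measurable B
  lawB : Q.map B = wienerLawC
  hG_le : ∀ k, G k ≤ mΩ'
  hG_mono : ∀ k, G k ≤ G (k + 1)
  hτ : ∀ k, Measurable[G k] (τ k)
  hHn : ∀ k, Measurable[G k] (Hn k)
  τ0 : ∀ ω, τ 0 ω = 0
  τ_mono : ∀ k ω, τ k ω ≤ τ (k + 1) ω
  H_X : ∀ k ≤ N, ∀ᵐ ω ∂Q, D.H k (X ω) = Hn k ω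
  val : ∀ k ≤ N, ∀ᵐ ω ∂Q, B ω (τ k ω) = D.M k (X ω)
  osc : ∀ k < N, ∀ᵐ ω ∂Q, ∀ t : ℝ≥0, τ k ω ≤ t → t ≤ τ (k + 1) ω → |B ω t - B ω (τ k ω)| ≤ 2 * D.δ
  int1 : ∀ k < N, Integrable (fun ω ↦ ((τ (k + 1) ω : ℝ) - τ k ω)) Q
  int2 : ∀ k < N, Integrable (fun ω ↦ ((τ (k + 1) ω : ℝ) - τ k ω) ^ 2) Q
  intW : ∀ k < N, Integrable (fun ω ↦ (B ω (τ (k + 1) ω) - B ω (τ k ω)) ^ 2) Q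
  mds : ∀ k < N, ∀ A, MeasurableSet[G k] A →
    ∫ ω in A, (((τ (k + 1) ω : ℝ) - τ k ω) - (B ω (τ (k + 1) ω) - B ω (τ k ω)) ^ 2) ∂Q = 0
  sqb : ∀ k < N, ∀ A, MeasurableSet[G k] A →
    ∫ ω in A, ((τ (k + 1) ω : ℝ) - τ k ω) ^ 2 ∂Q ≤ C4 * (4 * D.δ) ^ 4 * Q.real A
  trans : ∀ k < N, ∀ A, MeasurableSet[G k] A → ∀ c : Λ,
    Q.real (A ∩ {ω | Hn (k + 1) ω = c}) =
      ∫ ω in A, (if c ∈ D.children k (Hn k ω) then D.pc k (Hn k ω) c else 0) ∂Q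

attribute [instance] EmbeddingWitness.mΩ' EmbeddingWitness.prob

/-- **Embedding witnesses exist** (the Skorokhod embedding theorem `exists_embedding`).
[cite: LawlerSchrammWerner2004, Lemma 3.8] -/
theorem nonempty_embeddingWitness [BorelSpace C(ℝ≥0, ℝ)] [Nonempty Ω] (hD : D.IsValid) (hδ : 0 ≤ D.δ)
    (N : ℕ) : Nonempty (EmbeddingWitness D N) := by
  obtain ⟨Ω', mΩ', Q, prob, X, B, τ, G, Hn, hX, lawX, hB, lawB, hG_le, hG_mono, hτ, hHn, τ0, τ_mono,
    H_X, val, osc, int1, int2, intW, mds, sqb, trans⟩ := exists_embedding hD hδ N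
  exact ⟨⟨Ω', mΩ', Q, prob, X, B, τ, G, Hn, hX, lawX, hB, lawB, hG_le, hG_mono, hτ, hHn, τ0, τ_mono,
    H_X, val, osc, int1, int2, intW, mds, sqb, trans⟩⟩

namespace EmbeddingWitness

variable (E : EmbeddingWitness D N)

/-- The filtration of the witness as a Mathlib `Filtration`. [folklore] -/
def filtration : Filtration ℕ E.mΩ' :=
  ⟨E.G, monotone_nat_of_le_succ E.hG_mono, E.hG_le⟩

/-- **The atom values of the martingale along the embedded labels**: `Mval k (Hn k)` — a
`G k`-measurable version of `M k (X)`. [folklore] -/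
def Mv (k : ℕ) (ω : E.Ω') : ℝ := D.Mval k (E.Hn k ω)

/-- **The quadratic sums along the embedded labels**: `Ỹ_n = ∑_{j<n} (Mv_{j+1} - Mv_j)²` — a
`G n`-measurable version of `Y_n(X) = ∑_{j<n} (M_{j+1}(X) - M_j(X))²`. [folklore] -/
def quad (n : ℕ) (ω : E.Ω') : ℝ := ∑ j ∈ Finset.range n, (E.Mv (j + 1) ω - E.Mv j ω) ^ 2

/-- **The process `U_n = τ_n - Ỹ_n`**, frozen after the horizon `N`. Lawler–Schramm–Werner (2004),
§3.3 (`τ_n - Y_n`). [cite: LawlerSchrammWerner2004, Theorem 3.7] -/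
def U (n : ℕ) (ω : E.Ω') : ℝ := (E.τ (min n N) ω : ℝ) - E.quad (min n N) ω

/-! ### Measurability and integrability -/

omit [MeasurableSingletonClass Ω] in
/-- `Mv k` is `G j`-measurable for `k ≤ j`. [folklore] -/
theorem measurable_Mv {k j : ℕ} (hkj : k ≤ j) : Measurable[E.G j] (E.Mv k) := by
  have h : Measurable[E.G k] (E.Mv k) :=
    (measurable_of_countable (D.Mval k)).comp (E.hHn k)
  exact h.mono (E.filtration.mono hkj) le_rfl

omit [MeasurableSingletonClass Ω] in
/-- `quad n` is `G j`-measurable for `n ≤ j`. [folklore] -/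
theorem measurable_quad {n j : ℕ} (hnj : n ≤ j) : Measurable[E.G j] (E.quad n) := by
  refine Finset.measurable_sum (Finset.range n) fun i hi ↦ ?_
  have hi' : i + 1 ≤ j := (Finset.mem_range.1 hi).trans_le hnj |> Nat.succ_le_of_lt
  exact ((E.measurable_Mv hi').sub (E.measurable_Mv (Nat.le_of_succ_le hi'))).pow_const 2

omit [MeasurableSingletonClass Ω] [Countable Λ] [MeasurableSingletonClass Λ] in
/-- `τ k` (as a real) is `G j`-measurable for `k ≤ j`. [folklore] -/
theorem measurable_τ_real {k j : ℕ} (hkj : k ≤ j) : Measurable[E.G j] fun ω ↦ (E.τ k ω : ℝ) :=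
  (measurable_coe_nnreal_real.comp (E.hτ k)).mono (E.filtration.mono hkj) le_rfl

omit [MeasurableSingletonClass Ω] in
/-- `U` is adapted. [folklore] -/
theorem measurable_U (n : ℕ) : Measurable[E.G n] (E.U n) :=
  (E.measurable_τ_real (min_le_left n N)).sub (E.measurable_quad (min_le_left n N))

omit [MeasurableSingletonClass Ω] [Countable Λ] [MeasurableSingletonClass Λ] in
/-- The atom values are bounded by the maximum of `|M k|`. [folklore] -/
theorem abs_Mv_le (k : ℕ) (ω : E.Ω') : |E.Mv k ω| ≤ ∑ ω₀, |D.M k ω₀| := by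
  set l := E.Hn k ω
  change |D.Mval k l| ≤ _
  by_cases hl : D.pH k l = 0
  · rw [MartingaleData.Mval, hl, div_zero, abs_zero]
    exact Finset.sum_nonneg fun _ _ ↦ abs_nonneg _
  have hpos : 0 < D.pH k l := lt_of_le_of_ne (MartingaleData.pH_nonneg k l) (Ne.symm hl)
  rw [MartingaleData.Mval, abs_div, abs_of_pos hpos, div_le_iff₀ hpos]
  calc |∑ ω₀ ∈ D.atom k l, D.P.real {ω₀} * D.M k ω₀|
      ≤ ∑ ω₀ ∈ D.atom k l, |D.P.real {ω₀} * D.M k ω₀| := Finset.abs_sum_le_sum_abs _ _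
    _ ≤ ∑ ω₀ ∈ D.atom k l, D.P.real {ω₀} * ∑ ω₁, |D.M k ω₁| := Finset.sum_le_sum fun ω₀ _ ↦ by
        rw [abs_mul, abs_of_nonneg measureReal_nonneg]
        exact mul_le_mul_of_nonneg_left (Finset.single_le_sum (f := fun ω₁ ↦ |D.M k ω₁|)
          (fun _ _ ↦ abs_nonneg _) (Finset.mem_univ ω₀)) measureReal_nonneg
    _ = (∑ ω₁, |D.M k ω₁|) * D.pH k l := by rw [← Finset.sum_mul, MartingaleData.pH, mul_comm]

omit [MeasurableSingletonClass Ω] [Countable Λ] [MeasurableSingletonClass Λ] in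
/-- The quadratic sums are bounded. [folklore] -/
theorem abs_quad_le (n : ℕ) (ω : E.Ω') :
    |E.quad n ω| ≤ ∑ j ∈ Finset.range n, (∑ ω₀, |D.M (j + 1) ω₀| + ∑ ω₀, |D.M j ω₀|) ^ 2 := by
  rw [quad, abs_of_nonneg (Finset.sum_nonneg fun _ _ ↦ sq_nonneg _)]
  refine Finset.sum_le_sum fun j _ ↦ ?_
  rw [← sq_abs]
  refine pow_le_pow_left₀ (abs_nonneg _) ((abs_sub _ _).trans (add_le_add (E.abs_Mv_le _ _)
    (E.abs_Mv_le _ _))) 2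

omit [MeasurableSingletonClass Ω] [Countable Λ] [MeasurableSingletonClass Λ] in
/-- The embedding times up to the horizon are square integrable. [folklore] -/
theorem memLp_τ {k : ℕ} (hk : k ≤ N) : MemLp (fun ω ↦ (E.τ k ω : ℝ)) 2 E.Q := by
  induction k with
  | zero =>
    have : (fun ω ↦ (E.τ 0 ω : ℝ)) = fun _ ↦ 0 := funext fun ω ↦ by rw [E.τ0 ω]; rfl
    rw [this]; exact memLp_const 0
  | succ k ih =>
    have hk' : k < N := Nat.lt_of_succ_le hk
    have h1 : MemLp (fun ω ↦ ((E.τ (k + 1) ω : ℝ) - E.τ k ω)) 2 E.Q :=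
      (memLp_two_iff_integrable_sq (E.int1 k hk').aestronglyMeasurable).2 (E.int2 k hk')
    have h := (ih hk'.le).add h1
    have heq : (fun ω ↦ (E.τ k ω : ℝ)) + (fun ω ↦ ((E.τ (k + 1) ω : ℝ) - E.τ k ω)) =
        fun ω ↦ (E.τ (k + 1) ω : ℝ) := by
      funext ω; simp
    rwa [heq] at h

omit [MeasurableSingletonClass Ω] in
/-- The quadratic sums are square integrable (bounded). [folklore] -/
theorem memLp_quad (n : ℕ) : MemLp (E.quad n) 2 E.Q :=
  MemLp.of_bound ((E.measurable_quad le_rfl).mono (E.hG_le n) le_rfl).aestronglyMeasurable _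
    (ae_of_all _ fun ω ↦ by rw [Real.norm_eq_abs]; exact E.abs_quad_le n ω)

omit [MeasurableSingletonClass Ω] in
/-- `U` is square integrable. [folklore] -/
theorem memLp_U (n : ℕ) : MemLp (E.U n) 2 E.Q :=
  (E.memLp_τ (min_le_right n N)).sub (E.memLp_quad (min n N))

/-! ### Almost sure identifications -/

omit [MeasurableSpace C(ℝ≥0, ℝ)] [Countable Λ] [MeasurableSpace Λ] [MeasurableSingletonClass Λ] in
/-- Points of positive mass lie in non-null atoms; `X` a.s. avoids null atoms. [folklore] -/
theorem measure_pH_H_eq_zero (hD : D.IsValid) (k : ℕ) : D.P {ω₀ | D.pH k (D.H k ω₀) = 0} = 0 := by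
  haveI := hD.prob
  classical
  have hfin : {ω₀ | D.pH k (D.H k ω₀) = 0} = ↑(Finset.univ.filter fun ω₀ ↦ D.pH k (D.H k ω₀) = 0) := by
    ext ω₀; simp
  rw [hfin, ← measureReal_eq_zero_iff (measure_ne_top _ _), ← sum_measureReal_singleton]
  refine Finset.sum_eq_zero fun ω₀ hω₀ ↦ ?_
  simp only [Finset.mem_filter, Finset.mem_univ, true_and] at hω₀
  have hle : D.P.real {ω₀} ≤ D.pH k (D.H k ω₀) :=
    Finset.single_le_sum (f := fun ω ↦ D.P.real {ω}) (fun _ _ ↦ measureReal_nonneg)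
      ((D.mem_atom).2 rfl)
  rw [hω₀] at hle
  exact le_antisymm hle measureReal_nonneg

omit [Countable Λ] [MeasurableSingletonClass Λ] in
/-- A.s. the atom of `X` at every level is non-null. [folklore] -/
theorem ae_pH_H_X_ne_zero (hD : D.IsValid) (k : ℕ) : ∀ᵐ ω ∂E.Q, D.pH k (D.H k (E.X ω)) ≠ 0 := by
  have h : E.Q {ω | D.pH k (D.H k (E.X ω)) = 0} = 0 := by
    have := measure_pH_H_eq_zero hD k
    rw [← E.lawX, Measure.map_apply E.hX (Set.toFinite _).measurableSet] at this
    exact this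
  rw [ae_iff]
  simpa using h

omit [Countable Λ] [MeasurableSingletonClass Λ] in
/-- **A.s. `Mv k = M k (X)`** for `k ≤ N`. [folklore] -/
theorem ae_Mv_eq (hD : D.IsValid) {k : ℕ} (hk : k ≤ N) : ∀ᵐ ω ∂E.Q, E.Mv k ω = D.M k (E.X ω) := by
  filter_upwards [E.H_X k hk, E.ae_pH_H_X_ne_zero hD k] with ω hH hp
  rw [Mv, ← hH]
  exact MartingaleData.Mval_eq hD hp rfl

omit [Countable Λ] [MeasurableSingletonClass Λ] in
/-- **A.s. `B(τ k) = Mv k`** for `k ≤ N`. [folklore] -/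
theorem ae_B_τ_eq_Mv (hD : D.IsValid) {k : ℕ} (hk : k ≤ N) : ∀ᵐ ω ∂E.Q, E.B ω (E.τ k ω) = E.Mv k ω := by
  filter_upwards [E.val k hk, E.ae_Mv_eq hD hk] with ω h1 h2
  rw [h1, h2]

omit [Countable Λ] [MeasurableSingletonClass Λ] in
/-- **A.s. the quadratic sums along the labels are the quadratic sums of `M (X)`** (`n ≤ N`).
[folklore] -/
theorem ae_quad_eq (hD : D.IsValid) {n : ℕ} (hn : n ≤ N) :
    ∀ᵐ ω ∂E.Q, E.quad n ω = ∑ j ∈ Finset.range n, (D.M (j + 1) (E.X ω) - D.M j (E.X ω)) ^ 2 := by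
  have hall : ∀ᵐ ω ∂E.Q, ∀ k ∈ Finset.range (N + 1), E.Mv k ω = D.M k (E.X ω) :=
    (ae_ball_iff (Finset.countable_toSet _)).2 fun k hk ↦
      E.ae_Mv_eq hD (Nat.lt_succ_iff.1 (Finset.mem_range.1 hk))
  filter_upwards [hall] with ω hω
  refine Finset.sum_congr rfl fun j hj ↦ ?_
  have hj' : j < n := Finset.mem_range.1 hj
  rw [hω (j + 1) (Finset.mem_range.2 (by omega)), hω j (Finset.mem_range.2 (by omega))]

omit [Countable Λ] [MeasurableSingletonClass Λ] in
/-- A.s. the squared label increment is the squared path increment, bounded by `(2δ)²` (`k < N`).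
[folklore] -/
theorem ae_Mv_sub_sq (hD : D.IsValid) {k : ℕ} (hk : k < N) :
    ∀ᵐ ω ∂E.Q, (E.Mv (k + 1) ω - E.Mv k ω) ^ 2 = (E.B ω (E.τ (k + 1) ω) - E.B ω (E.τ k ω)) ^ 2 ∧
      (E.Mv (k + 1) ω - E.Mv k ω) ^ 2 ≤ (2 * D.δ) ^ 2 := by
  filter_upwards [E.ae_B_τ_eq_Mv hD hk.le, E.ae_B_τ_eq_Mv hD (Nat.succ_le_of_lt hk), E.osc k hk]
    with ω h1 h2 h3
  rw [← h1, ← h2]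
  refine ⟨rfl, ?_⟩
  rw [← sq_abs]
  exact pow_le_pow_left₀ (abs_nonneg _) (h3 _ (E.τ_mono k ω) le_rfl) 2

/-! ### `U` is a martingale with `O(δ⁴)` increments -/

omit [MeasurableSingletonClass Ω] [Countable Λ] [MeasurableSingletonClass Λ] in
/-- The increment of `U` before the horizon. [folklore] -/
theorem U_succ_sub {k : ℕ} (hk : k < N) (ω : E.Ω') :
    E.U (k + 1) ω - E.U k ω = ((E.τ (k + 1) ω : ℝ) - E.τ k ω) - (E.Mv (k + 1) ω - E.Mv k ω) ^ 2 := by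
  have h1 : min (k + 1) N = k + 1 := min_eq_left (Nat.succ_le_of_lt hk)
  have h2 : min k N = k := min_eq_left hk.le
  simp only [U, h1, h2, quad, Finset.sum_range_succ]
  ring

omit [MeasurableSingletonClass Ω] [Countable Λ] [MeasurableSingletonClass Λ] in
/-- After the horizon `U` is frozen. [folklore] -/
theorem U_succ_eq {k : ℕ} (hk : N ≤ k) (ω : E.Ω') : E.U (k + 1) ω = E.U k ω := by
  simp only [U, min_eq_right hk, min_eq_right (Nat.le_succ_of_le hk)]

/-- **`U_n = τ_n - Ỹ_n` is a martingale** for the embedding filtration: the compensator identity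
`E[τ_{n+1} - τ_n | G n] = E[(B_{τ_{n+1}} - B_{τ_n})² | G n]` and `(B_{τ_{n+1}} - B_{τ_n})² = (ΔỸ)_n`
a.s. Lawler–Schramm–Werner (2004), §3.3 ("`E[(τ_{n+1} - Y_{n+1}) - (τ_n - Y_n) | B[0,τ_n]] = 0`").
[cite: LawlerSchrammWerner2004, Theorem 3.7] -/
theorem martingale_U (hD : D.IsValid) : Martingale E.U E.filtration E.Q := by
  refine martingale_of_setIntegral_eq_succ (fun n ↦ (E.measurable_U n).stronglyMeasurable)
    (fun n ↦ (E.memLp_U n).integrable one_le_two) ?_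
  intro k A hA
  change MeasurableSet[E.G k] A at hA
  by_cases hk : k < N
  · rw [eq_comm, ← sub_eq_zero, ← integral_sub ((E.memLp_U (k + 1)).integrable one_le_two).integrableOn
      ((E.memLp_U k).integrable one_le_two).integrableOn]
    have hae : ∀ᵐ ω ∂E.Q, ω ∈ A → E.U (k + 1) ω - E.U k ω =
        ((E.τ (k + 1) ω : ℝ) - E.τ k ω) - (E.B ω (E.τ (k + 1) ω) - E.B ω (E.τ k ω)) ^ 2 := by
      filter_upwards [E.ae_Mv_sub_sq hD hk] with ω hω _
      rw [E.U_succ_sub hk, hω.1]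
    rw [setIntegral_congr_ae (E.hG_le k _ hA) hae]
    exact E.mds k hk A hA
  · refine setIntegral_congr_fun (E.hG_le k _ hA) fun ω _ ↦ ?_
    exact (E.U_succ_eq (not_lt.1 hk) ω).symm

/-- **The increments of `U` have second moment `O(δ⁴)`**:
`E[(U_{k+1} - U_k)²] ≤ (512 C₄ + 32) δ⁴` (`(a - b)² ≤ 2a² + 2b²`, the `δ⁴`-bound on `E[(Δτ)²]`
and `(ΔỸ)² ≤ (2δ)⁴`). Lawler–Schramm–Werner (2004), §3.3
("`E[((τ_{n+1} - Y_{n+1}) - (τ_n - Y_n))² | B[0,τ_n]] = O(δ⁴)`").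
[cite: LawlerSchrammWerner2004, Theorem 3.7] -/
theorem integral_U_succ_sub_sq_le (hD : D.IsValid) (k : ℕ) :
    ∫ ω, (E.U (k + 1) ω - E.U k ω) ^ 2 ∂E.Q ≤ (512 * C4 + 32) * D.δ ^ 4 := by
  have hC4 : 0 ≤ C4 := by rw [C4]; positivity
  by_cases hk : k < N
  · have h1 : ∫ ω, ((E.τ (k + 1) ω : ℝ) - E.τ k ω) ^ 2 ∂E.Q ≤ C4 * (4 * D.δ) ^ 4 := by
      have h := E.sqb k hk univ MeasurableSet.univ
      rw [Measure.restrict_univ, probReal_univ, mul_one] at h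
      exact h
    have hpt : ∀ᵐ ω ∂E.Q, (E.U (k + 1) ω - E.U k ω) ^ 2 ≤
        2 * ((E.τ (k + 1) ω : ℝ) - E.τ k ω) ^ 2 + 2 * (2 * D.δ) ^ 4 := by
      filter_upwards [E.ae_Mv_sub_sq hD hk] with ω hω
      rw [E.U_succ_sub hk]
      have hb : ((E.Mv (k + 1) ω - E.Mv k ω) ^ 2) ^ 2 ≤ ((2 * D.δ) ^ 2) ^ 2 :=
        pow_le_pow_left₀ (sq_nonneg _) hω.2 2
      nlinarith [sq_nonneg (((E.τ (k + 1) ω : ℝ) - E.τ k ω) + (E.Mv (k + 1) ω - E.Mv k ω) ^ 2)]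
    calc ∫ ω, (E.U (k + 1) ω - E.U k ω) ^ 2 ∂E.Q
        ≤ ∫ ω, (2 * ((E.τ (k + 1) ω : ℝ) - E.τ k ω) ^ 2 + 2 * (2 * D.δ) ^ 4) ∂E.Q :=
          integral_mono_ae ((E.memLp_U (k + 1)).sub (E.memLp_U k)).integrable_sq
            (((E.int2 k hk).const_mul 2).add (integrable_const _)) hpt
      _ = 2 * ∫ ω, ((E.τ (k + 1) ω : ℝ) - E.τ k ω) ^ 2 ∂E.Q + 2 * (2 * D.δ) ^ 4 := by
          rw [integral_add ((E.int2 k hk).const_mul 2) (integrable_const _), integral_const_mul,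
            integral_const, probReal_univ, one_smul]
      _ ≤ 2 * (C4 * (4 * D.δ) ^ 4) + 2 * (2 * D.δ) ^ 4 := by linarith
      _ = (512 * C4 + 32) * D.δ ^ 4 := by ring
  · have h0 : ∫ ω, (E.U (k + 1) ω - E.U k ω) ^ 2 ∂E.Q = 0 := by
      simp_rw [E.U_succ_eq (not_lt.1 hk), sub_self]; simp
    rw [h0]
    positivity

/-- **The embedding times follow the quadratic sums**: for `λ > 0`,
`Q{max_{k ≤ N} |τ_k - Ỹ_k| ≥ λ} ≤ N (512 C₄ + 32) δ⁴ / λ²` (Kolmogorov's inequality for `U`).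
Lawler–Schramm–Werner (2004), §3.3 ("Doob's inequality therefore implies
`P[max_{n≤N} |τ_n - Y_n| > δ^{1/2}] = O(Tδ)`"). [cite: LawlerSchrammWerner2004, Theorem 3.7] -/
theorem measureReal_max_U_ge_le (hD : D.IsValid) {lam : ℝ} (hlam : 0 < lam) :
    E.Q.real {ω | ∃ k ≤ N, lam ≤ |E.U k ω|} ≤ N * ((512 * C4 + 32) * D.δ ^ 4) / lam ^ 2 := by
  have h := measureReal_max_ge_le_of_martingale_nat (E.martingale_U hD) (E.memLp_U) hlam N
  have hz : ∫ ω, E.U 0 ω ^ 2 ∂E.Q = 0 := by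
    have : ∀ ω, E.U 0 ω = 0 := fun ω ↦ by simp [U, quad, E.τ0 ω]
    simp_rw [this]; simp
  rw [hz, zero_add] at h
  refine h.trans (div_le_div_of_nonneg_right ?_ (sq_nonneg lam))
  calc ∑ k ∈ Finset.range N, ∫ ω, (E.U (k + 1) ω - E.U k ω) ^ 2 ∂E.Q
      ≤ ∑ k ∈ Finset.range N, (512 * C4 + 32) * D.δ ^ 4 :=
        Finset.sum_le_sum fun k _ ↦ E.integral_U_succ_sub_sq_le hD k
    _ = N * ((512 * C4 + 32) * D.δ ^ 4) := by rw [Finset.sum_const, Finset.card_range, nsmul_eq_mul]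

/-- **The embedding times follow the quadratic sums of the embedded martingale**: for `λ > 0`,
`Q{∃ k ≤ N, λ ≤ |τ_k - ∑_{j<k} (M_{j+1}(X) - M_j(X))²|} ≤ N (512 C₄ + 32) δ⁴ / λ²`.
Lawler–Schramm–Werner (2004), §3.3. [cite: LawlerSchrammWerner2004, Theorem 3.7] -/
theorem measureReal_max_tau_sub_quad_ge_le (hD : D.IsValid) {lam : ℝ} (hlam : 0 < lam) :
    E.Q.real {ω | ∃ k ≤ N, lam ≤
      |(E.τ k ω : ℝ) - ∑ j ∈ Finset.range k, (D.M (j + 1) (E.X ω) - D.M j (E.X ω)) ^ 2|} ≤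
      N * ((512 * C4 + 32) * D.δ ^ 4) / lam ^ 2 := by
  have hall : ∀ᵐ ω ∂E.Q, ∀ k ∈ Finset.range (N + 1),
      E.quad k ω = ∑ j ∈ Finset.range k, (D.M (j + 1) (E.X ω) - D.M j (E.X ω)) ^ 2 :=
    (ae_ball_iff (Finset.countable_toSet _)).2 fun k hk ↦
      E.ae_quad_eq hD (Nat.lt_succ_iff.1 (Finset.mem_range.1 hk))
  have hae : {ω | ∃ k ≤ N, lam ≤
      |(E.τ k ω : ℝ) - ∑ j ∈ Finset.range k, (D.M (j + 1) (E.X ω) - D.M j (E.X ω)) ^ 2|} =ᵐ[E.Q]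
      {ω | ∃ k ≤ N, lam ≤ |E.U k ω|} := by
    filter_upwards [hall] with ω hω
    simp only [eq_iff_iff]
    constructor
    · rintro ⟨k, hk, h⟩
      refine ⟨k, hk, ?_⟩
      rwa [U, min_eq_left hk, hω k (Finset.mem_range.2 (Nat.lt_succ_of_le hk))]
    · rintro ⟨k, hk, h⟩
      refine ⟨k, hk, ?_⟩
      rwa [U, min_eq_left hk, hω k (Finset.mem_range.2 (Nat.lt_succ_of_le hk))] at h
  rw [measureReal_congr hae]
  exact E.measureReal_max_U_ge_le hD hlam

end EmbeddingWitness

end Literature.Probability.RandomPlanarGeometry.SkorokhodEmbedding
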